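import Summits.ResolutionOfSingularities.ResolutionOfSingularities.Theorems.HomologicalConductorNoZenoCurveIntersectionFinite
import Mathlib.Combinatorics.SimpleGraph.Finite
import HarnessLib

/-!
# Crux `NoZenoR` (stmt-ResolutionOfSingularities-19943), β layer — the INCIDENCE GRAPH of the exceptional curves (slot 5, UP-6)

Route `ResolutionOfSingularities/HomologicalConductor`, crux chain W4.4.  OURS (cell res-hironaka; lead res-L0-w44-lead-1 OFFER (o-UP6)
STATUS 18:40:19Z «`def incidenceGraph π : SimpleGraph X` (Adj η η′ := η ≠ η′ ∧ η, η′ ∈ excCurvePoints π ∧ (closure{η} ∩ closure{η′}).Nonempty)»;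
planner res-L0-w44-plan-1 DESK WORD 4); AI-written, weaker than expert review; nothing of the manuscript under review (Hironaka 2017) is
used and no Theses declaration is asserted.  ONE definition + unfolding API, so that the UP-6 acyclicity file (o-UP6), the (A3)
connectedness translation (`…NoZenoConnectedUnionWalk`) and G-comb (`…NoZenoTreeSeparation`) consume one typed graph and stay def-free.

* `incidenceGraph π : SimpleGraph X` — vertices: all points of `X` (only `excCurvePoints π` carry edges); `η — η′` iff `η ≠ η′` are
  (generic points of) integral exceptional curves of `π : X → Spec R` whose closures MEET.  This is the dual (incidence) graph of the
  exceptional configuration (Lipman 1969 §24 «the graph associated with the exceptional curves», p. 258 — context only; for a rational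
  singularity with split curves it is a tree, UP-6, NOT proved here).
* `incidenceGraph_adj`, `ne_of_adj`, `fst_mem_of_adj`, `snd_mem_of_adj`, `nonempty_inter_of_adj`, `finite_inter_of_adj` (adjacent curves meet in a
  FINITE non-empty set, `finite_closure_inter_closure_of_mem_excCurvePoints`), `adj_iff_exists_mem` (an edge = a common
  specialisation), `exists_adj_of_two_curves_through` (a point under two distinct exceptional curves gives an edge — the `𝒩₀`-dictionary),
  `support_subset_excCurvePoints`, `neighborSet_subset_excCurvePoints`, `finite_support` / `finite_neighborSet` / `finite_edgeSet`
  under `(excCurvePoints π).Finite`.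

References: J. Lipman, Publ. Math. IHÉS 36 (1969) §24 (p. 258) [`Lipman1969`] (context); The Stacks Project, Tag 0BA8 [`StacksProject`].
-/

-- single-problem summit: the doubled namespace component `ResolutionOfSingularities` is forced
set_option linter.dupNamespace false

noncomputable section

namespace Summit.ResolutionOfSingularities.ResolutionOfSingularities.Theorems.NoZeno.ExcCount

open CategoryTheory AlgebraicGeometry TopologicalSpace IsLocalRing
open Literature.AlgebraicGeometry.Resolution

variable {R : Type} [CommRing R] [IsLocalRing R] {X : Scheme.{0}} (π : X ⟶ Spec (.of R))

/-- The **incidence graph of the exceptional curves** of `π : X → Spec R` (`R` local): the simple graph on the points of `X` in which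
`η — η′` iff `η ≠ η′` are generic points of integral exceptional curves (`excCurvePoints π`: over the closed point, of height `1`) whose
closures `E_η = closure {η}`, `E_η′` MEET.  Only exceptional-curve points carry edges (`support_subset_excCurvePoints`).  (Lipman's graph
of the exceptional configuration, §24 p. 258 — the object of UP-6 «the incidence graph of a resolution of a rational surface germ with
split curves is a tree»; nothing about trees is asserted here.) [cite: Lipman1969, §24 (p. 258)] -/
def incidenceGraph : SimpleGraph X where
  Adj η η' := η ≠ η' ∧ η ∈ excCurvePoints π ∧ η' ∈ excCurvePoints π ∧
    (closure ({η} : Set X) ∩ closure {η'}).Nonempty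
  symm := ⟨fun _ _ h => ⟨h.1.symm, h.2.2.1, h.2.1, by rw [Set.inter_comm]; exact h.2.2.2⟩⟩
  loopless := ⟨fun _ h => h.1 rfl⟩

variable {π}

/-- Unfolding lemma for the adjacency of `incidenceGraph`. [this work] -/
theorem incidenceGraph_adj {η η' : X} :
    (incidenceGraph π).Adj η η' ↔ η ≠ η' ∧ η ∈ excCurvePoints π ∧ η' ∈ excCurvePoints π ∧
      (closure ({η} : Set X) ∩ closure {η'}).Nonempty :=
  Iff.rfl

/-- Adjacent vertices are distinct. [this work] -/
theorem ne_of_adj {η η' : X} (h : (incidenceGraph π).Adj η η') : η ≠ η' := h.1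

/-- The first end of an edge is an exceptional-curve point. [this work] -/
theorem fst_mem_of_adj {η η' : X} (h : (incidenceGraph π).Adj η η') : η ∈ excCurvePoints π := h.2.1

/-- The second end of an edge is an exceptional-curve point. [this work] -/
theorem snd_mem_of_adj {η η' : X} (h : (incidenceGraph π).Adj η η') : η' ∈ excCurvePoints π := h.2.2.1

/-- Adjacent curves meet. [this work] -/
theorem nonempty_inter_of_adj {η η' : X} (h : (incidenceGraph π).Adj η η') :
    (closure ({η} : Set X) ∩ closure {η'}).Nonempty := h.2.2.2

/-- **An edge is a common specialisation**: `η — η′` iff `η ≠ η′` are exceptional-curve points with a common specialisation `z`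
(`η ⤳ z`, `η′ ⤳ z`). [this work] -/
theorem adj_iff_exists_mem {η η' : X} :
    (incidenceGraph π).Adj η η' ↔ η ≠ η' ∧ η ∈ excCurvePoints π ∧ η' ∈ excCurvePoints π ∧ ∃ z : X, η ⤳ z ∧ η' ⤳ z := by
  rw [incidenceGraph_adj]
  refine and_congr_right fun _ => and_congr_right fun _ => and_congr_right fun _ => ?_
  constructor
  · rintro ⟨z, hz, hz'⟩
    exact ⟨z, specializes_iff_mem_closure.mpr hz, specializes_iff_mem_closure.mpr hz'⟩
  · rintro ⟨z, hz, hz'⟩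
    exact ⟨z, hz.mem_closure, hz'.mem_closure⟩

/-- **The `𝒩₀`-dictionary**: a point `z` lying under two DISTINCT integral exceptional curves `η ≠ η′` is witnessed by the edge
`η — η′`. [this work] -/
theorem exists_adj_of_two_curves_through {η η' z : X} (hne : η ≠ η') (hη : η ∈ excCurvePoints π) (hη' : η' ∈ excCurvePoints π)
    (hz : η ⤳ z) (hz' : η' ⤳ z) : (incidenceGraph π).Adj η η' :=
  adj_iff_exists_mem.mpr ⟨hne, hη, hη', z, hz, hz'⟩

/-- **Adjacent curves meet in a FINITE set** (`π` proper, `R` Noetherian local: two distinct height-one points of the Noetherian `X`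
have finitely many common specialisations, `finite_closure_inter_closure_of_mem_excCurvePoints`). [cite: StacksProject, Tag 0BA8] -/
theorem finite_inter_of_adj [IsNoetherianRing R] [IsProper π] {η η' : X} (h : (incidenceGraph π).Adj η η') :
    (closure ({η} : Set X) ∩ closure {η'}).Finite :=
  finite_closure_inter_closure_of_mem_excCurvePoints π (fst_mem_of_adj h) (snd_mem_of_adj h) (ne_of_adj h)

/-- Only exceptional-curve points carry edges: the support of the incidence graph lies in `excCurvePoints π`. [this work] -/
theorem support_subset_excCurvePoints : (incidenceGraph π).support ⊆ excCurvePoints π := by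
  rintro η ⟨η', h⟩
  exact fst_mem_of_adj h

/-- Neighbours are exceptional-curve points. [this work] -/
theorem neighborSet_subset_excCurvePoints (η : X) : (incidenceGraph π).neighborSet η ⊆ excCurvePoints π :=
  fun _ h => snd_mem_of_adj h

/-- With finitely many exceptional curves the support of the incidence graph is finite. [this work] -/
theorem finite_support (hfin : (excCurvePoints π).Finite) : ((incidenceGraph π).support).Finite :=
  hfin.subset support_subset_excCurvePoints

/-- With finitely many exceptional curves every vertex has finitely many neighbours. [this work] -/
theorem finite_neighborSet (hfin : (excCurvePoints π).Finite) (η : X) : ((incidenceGraph π).neighborSet η).Finite :=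
  hfin.subset (neighborSet_subset_excCurvePoints η)

/-- With finitely many exceptional curves the incidence graph has finitely many edges. [this work] -/
theorem finite_edgeSet (hfin : (excCurvePoints π).Finite) : ((incidenceGraph π).edgeSet).Finite := by
  classical
  -- every edge is the image of an (ordered) pair of exceptional-curve points
  refine ((hfin.prod hfin).image fun p : X × X => s(p.1, p.2)).subset ?_
  intro e he
  induction e using Sym2.ind with
  | _ η η' =>
    rw [SimpleGraph.mem_edgeSet] at he
    exact ⟨(η, η'), ⟨fst_mem_of_adj he, snd_mem_of_adj he⟩, rfl⟩

/-- A vertex outside `excCurvePoints π` is isolated. [this work] -/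
theorem not_adj_of_not_mem {η : X} (hη : η ∉ excCurvePoints π) (η' : X) : ¬ (incidenceGraph π).Adj η η' :=
  fun h => hη (fst_mem_of_adj h)

/-- The graph induced on a set of vertices `S` (Mathlib `SimpleGraph.induce`) has the same adjacency: for the UP-6 / G-comb
bookkeeping one may equivalently work on `excCurvePoints π` as vertex TYPE. [this work] -/
theorem induce_adj (S : Set X) (η η' : S) :
    ((incidenceGraph π).induce S).Adj η η' ↔ (incidenceGraph π).Adj η η' :=
  Iff.rfl

end Summit.ResolutionOfSingularities.ResolutionOfSingularities.Theorems.NoZeno.ExcCount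

end
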